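import Mathlib
import HarnessLib
import Literature.Dynamics.Hyperbolic.RGFlowStableManifoldSecondDiffSizes

/-!
# The second fixed point of the fine tuning ([ABKM19] Lemma 12.6), VIII: packaging the constants of
# the free-energy second difference — `≤ C · |Λ| · u₁ · u₂`

Continuation of `RGFlowStableManifoldSecondDiffSizes.lean` (`secondPertSize_fixedPoint_bilinear`:
the second-order size of four fixed points is `u₁u₂·K`) and of the free-energy assembly (the fixed-volume
second-difference bound of [ABKM19] Theorem 2.2 comes out as
`|Λ|c_qT₁₂ + 2|Λ|c_q²T₁T₂ + |Λ|T₁₂ + B₁₂/(1−R₀) + B₁B₂/(1−R₀)²` with `T_i = c·u_i`, `T₁₂ = u₁u₂K`,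
`B_i = (c_I + l_Iε)T_iη^N`, `B₁₂ = (c_IT₁₂ + 2l_I'T₁T₂ + (l_IT₁₂ + l_IIT₁T₂)ε)η^N`, `R₀ ≤ 3ε < 1`).  This file
is the pure real-arithmetic step turning that expression into `C·|Λ|·u₁u₂` with a constant `C` free of
`N` (using `η^N ≤ 1`, `1/(1−R₀) ≤ 1/(1−3ε)`, `|Λ| ≥ 1`):

* **`RGFlow.freeEnergy_secondDiff_bound_le`** (second differences), **`RGFlow.freeEnergy_sub_bound_le`**
  (first differences).

Everything is proved; no named fact.

## References
* S. Adams, S. Buchholz, R. Kotecký, S. Müller, arXiv:1910.13564, Theorem 2.2, Lemma 12.6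
  [AdamsBuchholzKoteckyMuller2019].
-/

noncomputable section

namespace Literature.Dynamics.Hyperbolic

namespace RGFlow

/-- **Packaging the constants of the free-energy second difference**: for `|Λ| = V ≥ 1`, `K, c_I, l_I, l_I', l_II,
u₁, u₂ ≥ 0`, `0 ≤ ε`, `3ε < 1`, `R₀ ≤ 3ε`, `0 ≤ η ≤ 1` (any real `c_q`, `c`):
`V c_q (u₁u₂K) + 2Vc_q²(cu₁)(cu₂) + V(u₁u₂K) + (c_I(u₁u₂K) + 2l_I'(cu₁)(cu₂) + (l_I(u₁u₂K) + l_II(cu₁)(cu₂))ε)η^N/(1−R₀)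
 + ((c_I + l_Iε)(cu₁)η^N)((c_I + l_Iε)(cu₂)η^N)/(1−R₀)² ≤ C·V·u₁·u₂` with
`C = c_qK + 2c_q²c² + K + (c_IK + 2l_I'c² + (l_IK + l_IIc²)ε)/(1−3ε) + (c_I + l_Iε)²c²/(1−3ε)²`.
[cite: AdamsBuchholzKoteckyMuller2019, Theorem 2.2] -/
theorem freeEnergy_secondDiff_bound_le {V cq K c cI lI lI' lII u₁ u₂ ε R₀ η : ℝ} {N : ℕ}
    (hV : 1 ≤ V) (hK : 0 ≤ K) (hcI : 0 ≤ cI) (hlI : 0 ≤ lI) (hlI' : 0 ≤ lI')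
    (hlII : 0 ≤ lII) (hu₁ : 0 ≤ u₁) (hu₂ : 0 ≤ u₂) (hε : 0 ≤ ε) (hε3 : 3 * ε < 1)
    (hR₀ε : R₀ ≤ 3 * ε) (hη : 0 ≤ η) (hη1 : η ≤ 1) :
    V * cq * (u₁ * u₂ * K) + 2 * V * cq ^ 2 * (c * u₁) * (c * u₂) + V * (u₁ * u₂ * K)
        + 1 / (1 - R₀) * ((cI * (u₁ * u₂ * K) + 2 * lI' * (c * u₁) * (c * u₂)
            + (lI * (u₁ * u₂ * K) + lII * (c * u₁) * (c * u₂)) * ε) * η ^ N)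
        + 1 / (1 - R₀) ^ 2 * ((cI + lI * ε) * (c * u₁) * η ^ N) * ((cI + lI * ε) * (c * u₂) * η ^ N)
      ≤ (cq * K + 2 * cq ^ 2 * c ^ 2 + K
          + (cI * K + 2 * lI' * c ^ 2 + (lI * K + lII * c ^ 2) * ε) / (1 - 3 * ε)
          + (cI + lI * ε) ^ 2 * c ^ 2 / (1 - 3 * ε) ^ 2) * V * u₁ * u₂ := by
  have hηN : η ^ N ≤ 1 := pow_le_one₀ hη hη1
  have hηN0 : 0 ≤ η ^ N := pow_nonneg hη N
  have h3 : 0 < 1 - 3 * ε := by linarith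
  have hR1 : 0 < 1 - R₀ := by linarith
  have hinv : 1 / (1 - R₀) ≤ 1 / (1 - 3 * ε) := one_div_le_one_div_of_le h3 (by linarith)
  have hinv0 : 0 ≤ 1 / (1 - R₀) := (div_pos one_pos hR1).le
  have hinv2 : 1 / (1 - R₀) ^ 2 ≤ 1 / (1 - 3 * ε) ^ 2 := by
    rw [one_div, one_div, ← inv_pow, ← inv_pow]
    refine pow_le_pow_left₀ (inv_pos.2 hR1).le ?_ 2
    simpa [one_div] using hinv
  have hinv20 : 0 ≤ 1 / (1 - R₀) ^ 2 := by positivity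
  have huu : 0 ≤ u₁ * u₂ := mul_nonneg hu₁ hu₂
  have hVuu : u₁ * u₂ ≤ V * (u₁ * u₂) := by nlinarith
  -- the fourth term
  set X₀ : ℝ := cI * K + 2 * lI' * c ^ 2 + (lI * K + lII * c ^ 2) * ε with hX₀
  have hX₀0 : 0 ≤ X₀ := by positivity
  have e4 : cI * (u₁ * u₂ * K) + 2 * lI' * (c * u₁) * (c * u₂) + (lI * (u₁ * u₂ * K) + lII * (c * u₁) * (c * u₂)) * ε
      = u₁ * u₂ * X₀ := by rw [hX₀]; ring
  have t4 : 1 / (1 - R₀) * ((cI * (u₁ * u₂ * K) + 2 * lI' * (c * u₁) * (c * u₂)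
        + (lI * (u₁ * u₂ * K) + lII * (c * u₁) * (c * u₂)) * ε) * η ^ N)
      ≤ X₀ / (1 - 3 * ε) * V * u₁ * u₂ := by
    rw [e4]
    calc 1 / (1 - R₀) * (u₁ * u₂ * X₀ * η ^ N)
        ≤ 1 / (1 - 3 * ε) * (u₁ * u₂ * X₀ * 1) := by
          refine mul_le_mul hinv ?_ (by positivity) (by positivity)
          exact mul_le_mul_of_nonneg_left hηN (by positivity)
      _ = X₀ / (1 - 3 * ε) * (u₁ * u₂) := by ring
      _ ≤ X₀ / (1 - 3 * ε) * (V * (u₁ * u₂)) :=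
          mul_le_mul_of_nonneg_left hVuu (div_nonneg hX₀0 h3.le)
      _ = X₀ / (1 - 3 * ε) * V * u₁ * u₂ := by ring
  -- the fifth term
  have t5 : 1 / (1 - R₀) ^ 2 * ((cI + lI * ε) * (c * u₁) * η ^ N) * ((cI + lI * ε) * (c * u₂) * η ^ N)
      ≤ (cI + lI * ε) ^ 2 * c ^ 2 / (1 - 3 * ε) ^ 2 * V * u₁ * u₂ := by
    have e5 : 1 / (1 - R₀) ^ 2 * ((cI + lI * ε) * (c * u₁) * η ^ N) * ((cI + lI * ε) * (c * u₂) * η ^ N)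
        = 1 / (1 - R₀) ^ 2 * ((cI + lI * ε) ^ 2 * c ^ 2 * (u₁ * u₂) * (η ^ N) ^ 2) := by ring
    rw [e5]
    have hη2 : (η ^ N) ^ 2 ≤ 1 := pow_le_one₀ hηN0 hηN
    calc 1 / (1 - R₀) ^ 2 * ((cI + lI * ε) ^ 2 * c ^ 2 * (u₁ * u₂) * (η ^ N) ^ 2)
        ≤ 1 / (1 - 3 * ε) ^ 2 * ((cI + lI * ε) ^ 2 * c ^ 2 * (u₁ * u₂) * 1) := by
          refine mul_le_mul hinv2 ?_ (by positivity) (by positivity)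
          exact mul_le_mul_of_nonneg_left hη2 (by positivity)
      _ = (cI + lI * ε) ^ 2 * c ^ 2 / (1 - 3 * ε) ^ 2 * (u₁ * u₂) := by ring
      _ ≤ (cI + lI * ε) ^ 2 * c ^ 2 / (1 - 3 * ε) ^ 2 * (V * (u₁ * u₂)) :=
          mul_le_mul_of_nonneg_left hVuu (by positivity)
      _ = (cI + lI * ε) ^ 2 * c ^ 2 / (1 - 3 * ε) ^ 2 * V * u₁ * u₂ := by ring
  -- the first three terms are exact
  have e123 : V * cq * (u₁ * u₂ * K) + 2 * V * cq ^ 2 * (c * u₁) * (c * u₂) + V * (u₁ * u₂ * K)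
      = (cq * K + 2 * cq ^ 2 * c ^ 2 + K) * V * u₁ * u₂ := by ring
  have efin : (cq * K + 2 * cq ^ 2 * c ^ 2 + K
          + (cI * K + 2 * lI' * c ^ 2 + (lI * K + lII * c ^ 2) * ε) / (1 - 3 * ε)
          + (cI + lI * ε) ^ 2 * c ^ 2 / (1 - 3 * ε) ^ 2) * V * u₁ * u₂
      = (cq * K + 2 * cq ^ 2 * c ^ 2 + K) * V * u₁ * u₂ + X₀ / (1 - 3 * ε) * V * u₁ * u₂
          + (cI + lI * ε) ^ 2 * c ^ 2 / (1 - 3 * ε) ^ 2 * V * u₁ * u₂ := by rw [hX₀]; ring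
  rw [efin]
  linarith [t4, t5, e123]

/-- **Packaging the constants of the free-energy first difference**: for `|Λ| = V ≥ 1`,
`c, c_I, l_I, u ≥ 0`, `0 ≤ ε`, `R₀ ≤ R₁ < 1`, `0 ≤ η ≤ 1` (any real `c_q`):
`V(c_q(cu)) + V(cu) + ((c_I + l_Iε)(cu)η^N)/(1−R₀) ≤ (c_qc + c + (c_I + l_Iε)c/(1−R₁))·V·u` — the
first-difference clause of [ABKM19] Theorem 2.2 in the form `≤ C·|Λ|·u` with `C` free of `N`.
[cite: AdamsBuchholzKoteckyMuller2019, Theorem 2.2] -/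
theorem freeEnergy_sub_bound_le {V cq c cI lI u ε R₀ R₁ η : ℝ} {N : ℕ}
    (hV : 1 ≤ V) (hc : 0 ≤ c) (hcI : 0 ≤ cI) (hlI : 0 ≤ lI) (hu : 0 ≤ u) (hε : 0 ≤ ε)
    (hR₀ : R₀ ≤ R₁) (hR₁ : R₁ < 1) (hη : 0 ≤ η) (hη1 : η ≤ 1) :
    V * (cq * (c * u)) + V * (c * u) + 1 / (1 - R₀) * ((cI + lI * ε) * (c * u) * η ^ N)
      ≤ (cq * c + c + (cI + lI * ε) * c / (1 - R₁)) * V * u := by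
  have hηN : η ^ N ≤ 1 := pow_le_one₀ hη hη1
  have h1 : 0 < 1 - R₁ := by linarith
  have hR : 0 < 1 - R₀ := by linarith
  have hinv : 1 / (1 - R₀) ≤ 1 / (1 - R₁) := one_div_le_one_div_of_le h1 (by linarith)
  have hVu : u ≤ V * u := by nlinarith
  have t3 : 1 / (1 - R₀) * ((cI + lI * ε) * (c * u) * η ^ N) ≤ (cI + lI * ε) * c / (1 - R₁) * V * u := by
    calc 1 / (1 - R₀) * ((cI + lI * ε) * (c * u) * η ^ N)
        ≤ 1 / (1 - R₁) * ((cI + lI * ε) * (c * u) * 1) := by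
          refine mul_le_mul hinv ?_ (by positivity) (by positivity)
          exact mul_le_mul_of_nonneg_left hηN (by positivity)
      _ = (cI + lI * ε) * c / (1 - R₁) * u := by ring
      _ ≤ (cI + lI * ε) * c / (1 - R₁) * (V * u) := mul_le_mul_of_nonneg_left hVu (by positivity)
      _ = (cI + lI * ε) * c / (1 - R₁) * V * u := by ring
  have e12 : V * (cq * (c * u)) + V * (c * u) = (cq * c + c) * V * u := by ring
  have efin : (cq * c + c + (cI + lI * ε) * c / (1 - R₁)) * V * u
      = (cq * c + c) * V * u + (cI + lI * ε) * c / (1 - R₁) * V * u := by ring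
  rw [efin]
  linarith [t3, e12]

end RGFlow

end Literature.Dynamics.Hyperbolic

end
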